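import Summits.RiemannHypothesis.RiemannHypothesis.Theorems.TiltedLandingLaw421R3LooseRecut

/-! # trkD_v12q — CANDIDATE skeleton (lens-2 g9 O10-b; WORKFILE ONLY — NOT a registry move: the line of record is `Lines/trkD_v11q.lean` e5f3c2cea72a0413;
a registry switch is a director + human decision).  ONE import, TREE: `…R3LooseRecut` (#1218; it imports `…R3Lens1Pinning`, `…R3RateSkeleton`,
`…R3TouchedGlueH`, `…Theses.EarlyAppointments`).  v11q's six stubs with ★A NARROWED to Ac′ = the class law over `Approach ∧ ¬Loose(4/5, BetaLevelQ 3)` at the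
SAME allowance literal; composition `RhW08.LooseRecut.law421R_of_recut` (TREE).  ★A ⟹ Ac′ (`ac'_of_starA`, TREE) so v12q is never harder than v11q, and every
★A bench transfers.  Ac′'s Γ-side decomposition (rev 7.3′, image `lens2/LooseRecutAdapt-v1.lean`): `stub_approachRecutC` ⇐
`RhW08.LooseRecutAdapt.approachRecut_of_TH_count_canonical hcF hL hT hrise hrest′ hfit‴` (T★ #1204 · Γ3″ #1205 · Γ4′ COUNT-typed over
`((Approach ∧ ¬Loose) ∖ β)` · FIT‴ #1217), or fit-free `…_count_residual`; Γ4 ⟹ Γ4′ (`rest'_of_rest`).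
Nothing here bears on the truth of RH; RH is not proved; all six stubs are OPEN; sorries ONLY inside `stub_*`. -/

namespace Summit.RiemannHypothesis.RiemannHypothesis.Cruxes.TiltedLandingLaw421R.TrkDV12Q

set_option linter.dupNamespace false

/-- OPEN SUCC analytic LAW stub (IDENTICAL to v11q): `RhW08.Lens1Pinning.TopPinning`. -/
theorem stub_topPinning : RhW08.Lens1Pinning.TopPinning := by
  sorry

/-- OPEN SUCC residual stub (IDENTICAL to v11q): `RhW08.Lens1Pinning.RegUmbrella11S`. -/
theorem stub_regUmbrella11S : RhW08.Lens1Pinning.RegUmbrella11S := by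
  sorry

/-- OPEN RATE stub F1 (IDENTICAL to v11q; F1′ over `Far ∨ Loose` follows by `RhW08.LooseRecut.f1'_iff_f1`): `RhW08.SealSwapQ.FarEnergyLawCQ (4/5)`. -/
theorem stub_farEnergyLawCQ : RhW08.SealSwapQ.FarEnergyLawCQ (4 / 5) := by
  sorry

/-- OPEN RATE stub F2c (IDENTICAL to v11q): `RhW08.SealSwapQ.EnergyRiseLawQ RhW08.BurgersRateG3.riseSupQ`. -/
theorem stub_energyRiseC : RhW08.SealSwapQ.EnergyRiseLawQ RhW08.BurgersRateG3.riseSupQ := by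
  sorry

/-- OPEN RATE stub Cc (IDENTICAL to v11q): `RhW08.SealSwapQ.ConsLawQ RhW08.BurgersRateG3.consSupQ`. -/
theorem stub_consC : RhW08.SealSwapQ.ConsLawQ RhW08.BurgersRateG3.consSupQ := by
  sorry

/-- OPEN RATE stub Ac′ (NARROWED from v11q's ★A `stub_approachC`: same allowance literal, class `Approach ∧ ¬Loose(4/5, BetaLevelQ 3)`). -/
theorem stub_approachRecutC :
    RhW08.LooseRecut.ApproachRecutAllowanceQ (4 / 5) (RhW08.TouchedGlueW.BetaLevelQ 3)
      (RhW08.RateSplit.approachBudgetHalfQ RhW08.BurgersRateG3.riseSupQ RhW08.BurgersRateG3.consSupQ) := by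
  sorry

/-- The crux BY NAME from the six stubs (`RhW08.LooseRecut.law421R_of_recut`, TREE #1218). -/
theorem TiltedLandingLaw421R_of : Summit.RiemannHypothesis.RiemannHypothesis.Theses.EarlyAppointments.TiltedLandingLaw421R :=
  RhW08.LooseRecut.law421R_of_recut (RhW08.TouchedGlueW.BetaLevelQ 3) stub_topPinning stub_regUmbrella11S
    stub_farEnergyLawCQ stub_energyRiseC stub_consC stub_approachRecutC

/-- (K) sanity (crit-1 L4): v11q's stub set (★A in place of Ac′) closes the crux through the v12q composition (`ac'_of_starA`). -/
theorem TiltedLandingLaw421R_of_starA (hP : RhW08.Lens1Pinning.TopPinning) (hU : RhW08.Lens1Pinning.RegUmbrella11S)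
    (hR2 : RhW08.SealSwapQ.FarEnergyLawCQ (4 / 5)) (hr : RhW08.SealSwapQ.EnergyRiseLawQ RhW08.BurgersRateG3.riseSupQ)
    (hC : RhW08.SealSwapQ.ConsLawQ RhW08.BurgersRateG3.consSupQ)
    (hA : RhW08.SealSwapQ.ApproachAllowanceQ (RhW08.RateSplit.approachBudgetHalfQ RhW08.BurgersRateG3.riseSupQ RhW08.BurgersRateG3.consSupQ)) :
    Summit.RiemannHypothesis.RiemannHypothesis.Theses.EarlyAppointments.TiltedLandingLaw421R :=
  RhW08.LooseRecut.law421R_of_recut (RhW08.TouchedGlueW.BetaLevelQ 3) hP hU hR2 hr hC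
    (RhW08.LooseRecut.ac'_of_starA (4 / 5) (RhW08.TouchedGlueW.BetaLevelQ 3) hA)

end Summit.RiemannHypothesis.RiemannHypothesis.Cruxes.TiltedLandingLaw421R.TrkDV12Q
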